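import Literature.Algebra.EuclideanLattices.LLLMachineTables
import Literature.Computability.Complexity.FoldBricks
import HarnessLib

/-!
# The Frank–Wolfe machine for `ϑ`, I: table codes, entrywise zips, saturated products, Frobenius sums, index lists

Topic `Computability/Complexity`; first of the files realising the saturated integer Frank–Wolfe
algorithm `ThetaFW.iterCap` / `ThetaFW.thetaZCap` (`Combinatorics/SimpleGraph/LovaszThetaFWCap.lean`)
as a polynomial-time string function, towards the discharge of
`Literature.Computability.Complexity.GLS1981_thetaApprox_unary_FP` (Grötschel–Lovász–Schrijver 1981,
§6: `ϑ` is approximable in polynomial time; accuracy in unary). The machine is written in the tree's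
`FP` string algebra exactly as the LLL machine (`Algebra/EuclideanLattices/LLLMachineTables.lean`,
whose codes `matCode`/`rowCode`/`zlist`, dot product `dotF` and saturated row-times-matrix product
`gramRowF` are reused verbatim): no Turing machine is written by hand; every routine is a total string
function on records `⟨x, ⟨…⟩⟩` carrying the *yardstick* `x` (`|x| = W`, the saturation width and the
clock of every loop), with membership in `FP` by composition lemmas, an `_apply` lemma on genuine
codes, and an output-length bound valid on **every** input. This file is the generic table layer:

* `tabCode g` — the code of a square table of strings `g : Fin n → Fin n → List Bool` (the coded list
  of its coded rows); `matCode N = tabCode (dpEnc ∘ N)` (`matCode_eq_tabCode`);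
* `mzipF f ⟨x, ⟨bin n, ⟨prm, ⟨T₁, T₂⟩⟩⟩⟩` — the entrywise zip of two tables under an item function
  `f ⟨x, ⟨prm, ⟨a, b⟩⟩⟩` (`zipLF` of `zipLF`), `mzipF_apply`, `mzipF_mem_FP`, `length_mzipF_le`;
* `mulCapF ⟨x, ⟨bin n, ⟨matCode A, matCode P⟩⟩⟩ = matCode (capM W (A ⊛ P))` — the saturated row-by-row
  product `(A ⊛ P)ᵢₖ = Σₗ Aᵢₗ Pₖₗ` (`ThetaFW.mulRR`), the map of `LLLMachine.gramRowItem`;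
* `frobF ⟨x, ⟨bin n, ⟨matCode X, matCode Y⟩⟩⟩ = dpEnc (Σᵢ Σₜ Xᵢₜ Yᵢₜ)` — the Frobenius inner product
  (traces `⟨1, N⟩`, entry sums `⟨J, N⟩`, and `Σ_E Nᵢⱼ²`), a `zipFoldLF` of `dotF` over the rows;
* `idxListF ⟨x, bin n⟩ = encList [1⁰, 1¹, …, 1ⁿ⁻¹]` (a `foldLoop`), and the tabulation
  `tab2F f ⟨x, ⟨bin n, prm⟩⟩ = tabCode (fun i j => f ⟨x, ⟨prm, ⟨1ⁱ, 1ʲ⟩⟩⟩)` (`mapLF` over the index list,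
  twice) by which the parser builds the adjacency/identity masks.

## References

* M. Grötschel, L. Lovász, A. Schrijver, Combinatorica 1 (1981) 169–197, §6 [GrotschelLovaszSchrijver1981]
  (the statement being discharged).
* M. Jaggi, arXiv:1108.1170 (2011), Alg. 6 [Jaggi2011] (the algorithm being implemented).
* S. Arora, B. Barak, *Computational Complexity: A Modern Approach*, CUP 2009, §1.3 (polynomial time is
  closed under composition and bounded loops) [AroraBarak2009].
-/

noncomputable section

namespace Literature.Computability.Complexity

namespace ThetaFWMachine

open _root_.Computability Polynomial Brick Literature.Algebra.EuclideanLattices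
  Literature.Algebra.EuclideanLattices.LLLMachine

variable {n : ℕ}

/-! ### Table codes -/

/-- The code of a square table of strings: the coded list of its coded rows. [folklore] -/
def tabCode (g : Fin n → Fin n → List Bool) : List Bool :=
  encList (List.ofFn fun i => encList (List.ofFn (g i)))

/-- A matrix code is the table code of the canonical codes of its entries. [folklore] -/
theorem matCode_eq_tabCode (N : Fin n → Fin n → ℤ) : matCode N = tabCode fun i j => dpEnc (N i j) := by
  unfold matCode tabCode rowCode
  refine congrArg encList (congrArg List.ofFn (funext fun i => ?_))
  rw [zlist_eq, List.map_ofFn]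
  rfl

/-- The rows of a table code. [folklore] -/
theorem tabCode_eq (g : Fin n → Fin n → List Bool) : tabCode g = encList (List.ofFn fun i => encList (List.ofFn (g i))) := rfl

/-! ### The entrywise zip of two tables -/

/-- The row function of `mzipF f` on `⟨x, ⟨⟨nn, prm⟩, ⟨r₁, r₂⟩⟩⟩`: the zip of `f` over `(r₁, r₂)` with
parameter `prm`. [folklore] -/
def mzipRow (f : List Bool → List Bool) : List Bool → List Bool :=
  zipLF f ∘ fanoutFn (nthF 0) (fanoutFn (fstF ∘ nthF 1) (fanoutFn (sndF ∘ nthF 1) (sndPow 1)))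

/-- `mzipRow f ∈ FP`. [folklore] -/
theorem mzipRow_mem_FP {f : List Bool → List Bool} (hF : f ∈ FP) {w : ℕ} (hw : w ≤ 2) {P : Polynomial ℕ}
    (hf : ∀ x p a b, (f (boolPair x (boolPair p (boolPair a b)))).length ≤ w * (a.length + b.length) + P.eval x.length) :
    mzipRow f ∈ FP :=
  comp_mem_FP (zipLF_mem_FP hF hw hf)
    (fanoutFn_mem_FP (nthF_mem_FP 0) (fanoutFn_mem_FP (comp_mem_FP fstF_mem_FP (nthF_mem_FP 1))
      (fanoutFn_mem_FP (comp_mem_FP sndF_mem_FP (nthF_mem_FP 1)) (sndPow_mem_FP 1))))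

/-- Output size of `mzipRow f`: `≤ w(|r₁| + |r₂|) + |x|(2P(|x|) + 4)`, in the item-function shape. [folklore] -/
theorem length_mzipRow_le {f : List Bool → List Bool} (w : ℕ) {P : Polynomial ℕ}
    (hf : ∀ x p a b, (f (boolPair x (boolPair p (boolPair a b)))).length ≤ w * (a.length + b.length) + P.eval x.length)
    (x p a b : List Bool) :
    (mzipRow f (boolPair x (boolPair p (boolPair a b)))).length ≤ w * (a.length + b.length) + (X * (2 * P + 4)).eval x.length := by
  rw [mzipRow, Function.comp_apply]
  set z := fanoutFn (nthF 0) (fanoutFn (fstF ∘ nthF 1) (fanoutFn (sndF ∘ nthF 1) (sndPow 1))) (boolPair x (boolPair p (boolPair a b)))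
  have h := length_zipLF_le (f := f) w hf z
  have e0 : fstF z = x := by simp [z]
  have e3 : nthF 3 z = a := by simp [z]
  have e4 : sndPow 3 z = b := by simp [z]
  rw [e0, e3, e4] at h
  simpa [eval_add, eval_mul, eval_X, eval_ofNat] using h

/-- Semantics of `mzipRow f` on coded rows (`n ≤ |x|`). [folklore] -/
theorem mzipRow_apply (f : List Bool → List Bool) (x : List Bool) (hn : n ≤ x.length) (prm : List Bool) (g h : Fin n → List Bool) :
    mzipRow f (boolPair x (boolPair (boolPair (encodeNat n) prm) (boolPair (encList (List.ofFn g)) (encList (List.ofFn h))))) =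
      encList (List.ofFn fun j => f (boolPair x (boolPair prm (boolPair (g j) (h j))))) := by
  simp only [mzipRow, Function.comp_apply, fanoutFn_apply, nthF_zero_boolPair, nthF_succ_boolPair, sndPow_succ_boolPair,
    sndPow_zero, sndF_boolPair, fstF_boolPair]
  rw [zipLF_apply _ _ _ hn, List.take_of_length_le (by simp), List.take_of_length_le (by simp), zipImages_ofFn]

/-- **The entrywise zip of two tables** on `⟨x, ⟨nn, ⟨prm, ⟨T₁, T₂⟩⟩⟩⟩`: the table of
`f ⟨x, ⟨prm, ⟨aᵢⱼ, bᵢⱼ⟩⟩⟩`. [cite: AroraBarak2009, §1.3 (bounded loops)] -/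
def mzipF (f : List Bool → List Bool) : List Bool → List Bool :=
  zipLF (mzipRow f) ∘ fanoutFn (nthF 0) (fanoutFn (nthF 1) (fanoutFn (fanoutFn (nthF 1) (nthF 2)) (sndPow 2)))

/-- `mzipF f ∈ FP`. [folklore] -/
theorem mzipF_mem_FP {f : List Bool → List Bool} (hF : f ∈ FP) {w : ℕ} (hw : w ≤ 2) {P : Polynomial ℕ}
    (hf : ∀ x p a b, (f (boolPair x (boolPair p (boolPair a b)))).length ≤ w * (a.length + b.length) + P.eval x.length) :
    mzipF f ∈ FP :=
  comp_mem_FP (zipLF_mem_FP (mzipRow_mem_FP hF hw hf) hw (length_mzipRow_le w hf))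
    (fanoutFn_mem_FP (nthF_mem_FP 0) (fanoutFn_mem_FP (nthF_mem_FP 1)
      (fanoutFn_mem_FP (fanoutFn_mem_FP (nthF_mem_FP 1) (nthF_mem_FP 2)) (sndPow_mem_FP 2))))

/-- **Semantics of `mzipF`** on table codes (`n ≤ |x|`). [folklore] -/
theorem mzipF_apply (f : List Bool → List Bool) (x : List Bool) (hn : n ≤ x.length) (prm : List Bool)
    (g h : Fin n → Fin n → List Bool) :
    mzipF f (boolPair x (boolPair (encodeNat n) (boolPair prm (boolPair (tabCode g) (tabCode h))))) =
      tabCode fun i j => f (boolPair x (boolPair prm (boolPair (g i j) (h i j)))) := by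
  simp only [mzipF, Function.comp_apply, fanoutFn_apply, nthF_zero_boolPair, nthF_succ_boolPair, sndPow_succ_boolPair,
    sndPow_zero, sndF_boolPair, tabCode]
  rw [zipLF_apply _ _ _ hn, List.take_of_length_le (by simp), List.take_of_length_le (by simp), zipImages_ofFn]
  refine congrArg encList (congrArg List.ofFn (funext fun i => ?_))
  exact mzipRow_apply f x hn prm (g i) (h i)

/-- **Output size of `mzipF f`**: `≤ w(|T₁| + |T₂|) + |x|(2|x|(2P(|x|)+4) + 4)` (absolute for `w = 0`).
[folklore] -/
theorem length_mzipF_le {f : List Bool → List Bool} (w : ℕ) {P : Polynomial ℕ}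
    (hf : ∀ x p a b, (f (boolPair x (boolPair p (boolPair a b)))).length ≤ w * (a.length + b.length) + P.eval x.length)
    (z : List Bool) :
    (mzipF f z).length ≤ w * ((nthF 3 z).length + (sndPow 3 z).length) +
      (fstF z).length * (2 * ((fstF z).length * (2 * P.eval (fstF z).length + 4)) + 4) := by
  rw [mzipF, Function.comp_apply]
  set v := fanoutFn (nthF 0) (fanoutFn (nthF 1) (fanoutFn (fanoutFn (nthF 1) (nthF 2)) (sndPow 2))) z
  have h := length_zipLF_le (f := mzipRow f) w (P := X * (2 * P + 4)) (length_mzipRow_le w hf) v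
  have e0 : fstF v = fstF z := by simp [v]
  have e3 : nthF 3 v = nthF 3 z := by simp [v]
  have e4 : sndPow 3 v = sndPow 3 z := by simp [v]
  rw [e0, e3, e4] at h
  simpa [eval_add, eval_mul, eval_X, eval_ofNat] using h


/-! ### The saturated row-by-row product -/

/-- **The saturated row-by-row product** on `⟨x, ⟨nn, ⟨M_A, M_P⟩⟩⟩`: the map over the rows `aᵢ` of `M_A`
of the saturated row-times-matrix product `LLLMachine.gramRowF ⟨x, ⟨nn, ⟨aᵢ, M_P⟩⟩⟩`, i.e. the code of
`(i, k) ↦ capZ |x| (Σₜ Aᵢₜ Pₖₜ)` (`ThetaFW.capM W (mulRR A P)`). [cite: Jaggi2011, §4, Thm. 18 (power iteration)] -/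
def mulCapF : List Bool → List Bool :=
  mapLF gramRowItem ∘ fanoutFn (nthF 0) (fanoutFn (nthF 1) (fanoutFn (fanoutFn (nthF 1) (sndPow 2)) (nthF 2)))

/-- `mulCapF ∈ FP`. [folklore] -/
theorem mulCapF_mem_FP : mulCapF ∈ FP :=
  comp_mem_FP (mapLF_mem_FP gramRowItem_mem_FP (w := 0) (by norm_num) length_gramRowItem_le)
    (fanoutFn_mem_FP (nthF_mem_FP 0) (fanoutFn_mem_FP (nthF_mem_FP 1)
      (fanoutFn_mem_FP (fanoutFn_mem_FP (nthF_mem_FP 1) (sndPow_mem_FP 2)) (nthF_mem_FP 2))))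

/-- **Semantics of `mulCapF`** (`n ≤ |x|`). [folklore] -/
theorem mulCapF_apply (x : List Bool) (hn : n ≤ x.length) (A P : Fin n → Fin n → ℤ) :
    mulCapF (boolPair x (boolPair (encodeNat n) (boolPair (matCode A) (matCode P)))) =
      matCode fun i k => capZ x.length (∑ t, A i t * P k t) := by
  simp only [mulCapF, Function.comp_apply, fanoutFn_apply, nthF_zero_boolPair, nthF_succ_boolPair, sndPow_succ_boolPair,
    sndPow_zero, sndF_boolPair]
  rw [show matCode A = encList (List.ofFn fun i => rowCode (A i)) from rfl, mapLF_apply _ _ _ hn,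
    List.take_of_length_le (by simp), List.map_ofFn, matCode]
  refine congrArg encList (congrArg List.ofFn (funext fun i => ?_))
  simp only [gramRowItem, Function.comp_apply, fanoutFn_apply, nthF_zero_boolPair, nthF_succ_boolPair, sndPow_succ_boolPair,
    sndPow_zero, sndF_boolPair, fstF_boolPair]
  rw [show encList (List.ofFn fun i => rowCode (P i)) = matCode P from rfl, gramRowF_apply x hn P (A i)]
  rfl

/-- Length of `mulCapF`: absolute, `≤ |x| (2|x|(4|x|+8) + 4)`. [folklore] -/
theorem length_mulCapF_le (z : List Bool) :
    (mulCapF z).length ≤ (fstF z).length * (2 * ((fstF z).length * (4 * (fstF z).length + 8)) + 4) := by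
  rw [mulCapF, Function.comp_apply]
  set w := fanoutFn (nthF 0) (fanoutFn (nthF 1) (fanoutFn (fanoutFn (nthF 1) (sndPow 2)) (nthF 2))) z
  have h := length_mapLF_le (f := gramRowItem) 0 (P := X * (4 * X + 8)) length_gramRowItem_le w
  have e0 : fstF w = fstF z := by simp [w]
  rw [e0] at h
  simpa [eval_add, eval_mul, eval_X, eval_ofNat] using h

/-! ### The Frobenius inner product -/

/-- The accumulation step of the Frobenius sum on `⟨x, ⟨p, ⟨a, ⟨b, acc⟩⟩⟩⟩`: `acc + dotF ⟨x, ⟨p, ⟨a, b⟩⟩⟩`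
(sign-free accumulation `iaddFn`). [folklore] -/
def frobStep : List Bool → List Bool :=
  iaddFn ∘ fanoutFn (sndPow 3) (dotF ∘ fanoutFn (nthF 0) (fanoutFn (nthF 1) (fanoutFn (nthF 2) (nthF 3))))

/-- `frobStep ∈ FP`. [folklore] -/
theorem frobStep_mem_FP : frobStep ∈ FP :=
  comp_mem_FP iaddFn_mem_FP (fanoutFn_mem_FP (sndPow_mem_FP 3) (comp_mem_FP dotF_mem_FP
    (fanoutFn_mem_FP (nthF_mem_FP 0) (fanoutFn_mem_FP (nthF_mem_FP 1) (fanoutFn_mem_FP (nthF_mem_FP 2) (nthF_mem_FP 3))))))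

/-- Value of the accumulation step. [folklore] -/
theorem ival_frobStep (x p a b acc : List Bool) :
    ival (frobStep (boolPair x (boolPair p (boolPair a (boolPair b acc))))) =
      ival acc + ival (dotF (boolPair x (boolPair p (boolPair a b)))) := by
  simp [frobStep]

/-- Growth of the accumulation step: `≤ |acc| + 2(|a| + |b|) + 14|x| + 11`. [folklore] -/
theorem length_frobStep_le (x p a b acc : List Bool) :
    (frobStep (boolPair x (boolPair p (boolPair a (boolPair b acc))))).length ≤
      acc.length + 2 * (a.length + b.length) + (14 * X + 11 : Polynomial ℕ).eval x.length := by
  have h1 := length_iaddFn_boolPair_le acc (dotF (boolPair x (boolPair p (boolPair a b))))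
  have h2 := length_dotF_le (boolPair x (boolPair p (boolPair a b)))
  simp only [nthF_succ_boolPair, nthF_zero_boolPair, sndPow_succ_boolPair, sndPow_zero, sndF_boolPair, fstF_boolPair] at h2
  simp only [frobStep, Function.comp_apply, fanoutFn_apply, sndPow_succ_boolPair, sndPow_zero, sndF_boolPair,
    nthF_succ_boolPair, nthF_zero_boolPair, eval_add, eval_mul, eval_ofNat, eval_X]
  omega

/-- **The Frobenius inner product** on `⟨x, ⟨nn, ⟨M_X, M_Y⟩⟩⟩`: the canonical code of `Σᵢ Σₜ Xᵢₜ Yᵢₜ`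
(the fold of `frobStep` over the zipped rows, from `0`). [folklore] -/
def frobF : List Bool → List Bool :=
  zcanonF ∘ zipFoldLF frobStep ∘
    fanoutFn (nthF 0) (fanoutFn (nthF 1) (fanoutFn (nthF 1) (fanoutFn (nthF 2) (fanoutFn (sndPow 2) (fun _ => dpEnc 0)))))

/-- `frobF ∈ FP`. [folklore] -/
theorem frobF_mem_FP : frobF ∈ FP :=
  comp_mem_FP zcanonF_mem_FP (comp_mem_FP (zipFoldLF_mem_FP frobStep_mem_FP (P := 14 * X + 11) length_frobStep_le)
    (fanoutFn_mem_FP (nthF_mem_FP 0) (fanoutFn_mem_FP (nthF_mem_FP 1) (fanoutFn_mem_FP (nthF_mem_FP 1)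
      (fanoutFn_mem_FP (nthF_mem_FP 2) (fanoutFn_mem_FP (sndPow_mem_FP 2) (const_mem_FP _)))))))

/-- The value of the folded accumulation. [folklore] -/
theorem ival_zipFoldValue_frobStep (x p : List Bool) : ∀ (A B : List (List Bool)) (init : List Bool),
    ival (zipFoldValue frobStep x p A B init) =
      ival init + ((A.zip B).map fun ab => ival (dotF (boolPair x (boolPair p (boolPair ab.1 ab.2))))).sum
  | [], B, init => by simp [zipFoldValue]
  | a :: A, [], init => by simp [zipFoldValue]
  | a :: A, b :: B, init => by
    have := ival_zipFoldValue_frobStep x p A B (frobStep (boolPair x (boolPair p (boolPair a (boolPair b init)))))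
    simp only [zipFoldValue, List.zip_cons_cons, List.foldl_cons, List.map_cons, List.sum_cons] at this ⊢
    rw [this, ival_frobStep]; ring

/-- **Semantics of `frobF`** (`n ≤ |x|`): `frobF ⟨x, ⟨bin n, ⟨matCode X, matCode Y⟩⟩⟩ = dpEnc (Σᵢ Σₜ Xᵢₜ Yᵢₜ)`.
[folklore] -/
theorem frobF_apply (x : List Bool) (hn : n ≤ x.length) (M N : Fin n → Fin n → ℤ) :
    frobF (boolPair x (boolPair (encodeNat n) (boolPair (matCode M) (matCode N)))) = dpEnc (∑ i, ∑ t, M i t * N i t) := by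
  simp only [frobF, Function.comp_apply, fanoutFn_apply, nthF_zero_boolPair, nthF_succ_boolPair, sndPow_succ_boolPair,
    sndPow_zero, sndF_boolPair, matCode]
  rw [zipFoldLF_apply _ _ _ hn, zcanonF_eq, ival_zipFoldValue_frobStep, List.take_of_length_le (by simp),
    List.take_of_length_le (by simp), ival_dpEnc, zero_add, zip_ofFn, List.map_ofFn, List.sum_ofFn]
  refine congrArg dpEnc (Finset.sum_congr rfl fun i _ => ?_)
  simp only [Function.comp_apply]
  rw [dotF_apply x hn, ival_dpEnc]

/-- Length of `frobF`: `≤ 2 (|M_X| + |M_Y| + 2 + |x| (14|x| + 11)) + 2` in terms of the fields of the argument.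
[folklore] -/
theorem length_frobF_le (z : List Bool) :
    (frobF z).length ≤ 2 * ((nthF 2 z).length + (sndPow 2 z).length + 2 + (fstF z).length * (14 * (fstF z).length + 11)) + 2 := by
  rw [frobF, Function.comp_apply, Function.comp_apply, zcanonF_eq]
  set w := fanoutFn (nthF 0) (fanoutFn (nthF 1) (fanoutFn (nthF 1) (fanoutFn (nthF 2) (fanoutFn (sndPow 2) (fun _ => dpEnc 0))))) z
  have h := length_zipFoldLF_le (f := frobStep) (P := 14 * X + 11) length_frobStep_le w
  have e3 : nthF 3 w = nthF 2 z := by simp [w]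
  have e4 : nthF 4 w = sndPow 2 z := by simp [w]
  have e5 : sndPow 4 w = dpEnc 0 := by simp [w]
  have e0 : fstF w = fstF z := by simp [w]
  rw [e3, e4, e5, e0, dpEnc_zero, length_boolPair] at h
  simp only [List.length_nil, eval_add, eval_mul, eval_ofNat, eval_X] at h
  have h2 := length_dpEnc_le_two_mul (ival (zipFoldLF frobStep w))
  have h3 := length_encodeNat_natAbs_ival_le (zipFoldLF frobStep w)
  have h4 := zlen_le_length (zipFoldLF frobStep w)
  omega

/-! ### The list of unary indices -/

/-- A `ccat` of cons cells is a coded list (`encList` is a monoid morphism, cf.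
`FregeTransl.encList_append` in `MetaComplexity/FregeTranslation.lean`, not imported here). [folklore] -/
theorem ccat_boolPair_nil (g : ℕ → List Bool) : ∀ k, ccat (fun j => boolPair (g j) []) k = encList ((List.range k).map g)
  | 0 => rfl
  | k + 1 => by
    have happ : ∀ L₁ L₂ : List (List Bool), encList (L₁ ++ L₂) = encList L₁ ++ encList L₂ := by
      intro L₁ L₂
      induction L₁ with
      | nil => rfl
      | cons a L ih => rw [List.cons_append, encList_cons, encList_cons, ih]; simp [boolPair]
    rw [ccat_succ, ccat_boolPair_nil g k, List.range_succ, List.map_append, happ, List.map_singleton,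
      encList_cons, encList_nil]

/-- `List.ofFn` through `Fin.val` is a map over `List.range`. [folklore] -/
theorem ofFn_val_eq_map_range {α : Type*} (F : ℕ → α) (k : ℕ) : (List.ofFn fun i : Fin k => F i) = (List.range k).map F := by
  apply List.ext_getElem (by simp)
  intro i h₁ h₂
  simp

/-- The piece function of the index list on `⟨x, u⟩`: the cons cell `⟨u, ε⟩`. [folklore] -/
def idxPiece : List Bool → List Bool := fanoutFn sndF (fun _ => [])

/-- `idxPiece ∈ FP`. [folklore] -/
theorem idxPiece_mem_FP : idxPiece ∈ FP := fanoutFn_mem_FP sndF_mem_FP (const_mem_FP _)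

/-- `idxPiece ⟨x, u⟩ = ⟨u, ε⟩`. [folklore] -/
@[simp] theorem idxPiece_boolPair (x u : List Bool) : idxPiece (boolPair x u) = boolPair u [] := by simp [idxPiece]

/-- **The list of unary indices** on `⟨x, nn⟩`: `encList [1⁰, 1¹, …, 1ⁿ⁻¹]` for `n = ⟦nn⟧ ≤ |x|` (the
concatenation fold of the clipped cons cells `⟨1ⁱ, ε⟩`). [cite: AroraBarak2009, §1.3 (bounded loops)] -/
def idxListF : List Bool → List Bool :=
  sndPow 2 ∘ foldLoop appF (clipF 2 idxPiece) X ∘ fanoutFn fstF (fanoutFn sndF (fun _ => boolPair [] []))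

/-- `idxListF ∈ FP`. [folklore] -/
theorem idxListF_mem_FP : idxListF ∈ FP :=
  comp_mem_FP (sndPow_mem_FP 2) (comp_mem_FP (foldLoop_clipF_mem_FP 2 appF_mem_FP length_appF_le idxPiece_mem_FP X)
    (fanoutFn_mem_FP fstF_mem_FP (fanoutFn_mem_FP sndF_mem_FP (const_mem_FP _))))

/-- **Semantics of `idxListF`** (`n ≤ |x|`). [folklore] -/
theorem idxListF_apply (x : List Bool) (hn : n ≤ x.length) :
    idxListF (boolPair x (encodeNat n)) = encList (List.ofFn fun i : Fin n => ones i) := by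
  have h0 : fanoutFn fstF (fanoutFn sndF (fun _ => boolPair [] [])) (boolPair x (encodeNat n)) =
      boolPair x (boolPair (encodeNat n) (boolPair (ones 0) [])) := by simp [ones]
  rw [idxListF, Function.comp_apply, Function.comp_apply, h0, foldLoop_apply _ _ (by simpa using hn) 0 []]
  simp only [sndPow_succ_boolPair, sndPow_zero, sndF_boolPair]
  rw [foldAcc_clipF (fun j _ hj => by simp only [idxPiece_boolPair, length_boolPair, List.length_nil]; simp [ones]; omega),
    foldAcc_appF, List.nil_append, ofFn_val_eq_map_range]
  simp only [zero_add, idxPiece_boolPair]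
  exact ccat_boolPair_nil ones n

/-! ### Tabulation from unary indices -/

/-- The item function of `tab2F f` on `⟨x, ⟨⟨prm, u⟩, v⟩⟩`: `f ⟨x, ⟨prm, ⟨u, v⟩⟩⟩`. [folklore] -/
def tabItem (f : List Bool → List Bool) : List Bool → List Bool :=
  f ∘ fanoutFn (nthF 0) (fanoutFn (fstF ∘ nthF 1) (fanoutFn (sndF ∘ nthF 1) (sndPow 1)))

/-- `tabItem f ∈ FP`. [folklore] -/
theorem tabItem_mem_FP {f : List Bool → List Bool} (hF : f ∈ FP) : tabItem f ∈ FP :=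
  comp_mem_FP hF (fanoutFn_mem_FP (nthF_mem_FP 0) (fanoutFn_mem_FP (comp_mem_FP fstF_mem_FP (nthF_mem_FP 1))
    (fanoutFn_mem_FP (comp_mem_FP sndF_mem_FP (nthF_mem_FP 1)) (sndPow_mem_FP 1))))

/-- `tabItem f` on a record. [folklore] -/
theorem tabItem_boolPair (f : List Bool → List Bool) (x p a : List Bool) :
    tabItem f (boolPair x (boolPair p a)) = f (boolPair x (boolPair (fstF p) (boolPair (sndF p) a))) := by
  simp [tabItem]

/-- Size of `tabItem f` for an absolutely bounded `f`. [folklore] -/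
theorem length_tabItem_le {f : List Bool → List Bool} {P : Polynomial ℕ}
    (hf : ∀ x p a b, (f (boolPair x (boolPair p (boolPair a b)))).length ≤ P.eval x.length) (x p a : List Bool) :
    (tabItem f (boolPair x (boolPair p a))).length ≤ 0 * a.length + P.eval x.length := by
  rw [tabItem_boolPair, zero_mul, zero_add]; exact hf x _ _ a

/-- The row function of `tab2F f` on `⟨x, ⟨⟨nn, ⟨prm, U⟩⟩, u⟩⟩`: the map of `tabItem f` over the index list `U`
with parameter `⟨prm, u⟩`. [folklore] -/
def tabRow (f : List Bool → List Bool) : List Bool → List Bool :=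
  mapLF (tabItem f) ∘ fanoutFn (nthF 0) (fanoutFn (fstF ∘ nthF 1)
    (fanoutFn (fanoutFn (fstF ∘ sndF ∘ nthF 1) (sndPow 1)) (sndF ∘ sndF ∘ nthF 1)))

/-- `tabRow f ∈ FP`. [folklore] -/
theorem tabRow_mem_FP {f : List Bool → List Bool} (hF : f ∈ FP) {P : Polynomial ℕ}
    (hf : ∀ x p a b, (f (boolPair x (boolPair p (boolPair a b)))).length ≤ P.eval x.length) : tabRow f ∈ FP :=
  comp_mem_FP (mapLF_mem_FP (tabItem_mem_FP hF) (w := 0) (by norm_num) (length_tabItem_le hf))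
    (fanoutFn_mem_FP (nthF_mem_FP 0) (fanoutFn_mem_FP (comp_mem_FP fstF_mem_FP (nthF_mem_FP 1))
      (fanoutFn_mem_FP (fanoutFn_mem_FP (comp_mem_FP fstF_mem_FP (comp_mem_FP sndF_mem_FP (nthF_mem_FP 1))) (sndPow_mem_FP 1))
        (comp_mem_FP sndF_mem_FP (comp_mem_FP sndF_mem_FP (nthF_mem_FP 1))))))

/-- Size of `tabRow f`: absolute, `≤ |x|(2P(|x|) + 4)`. [folklore] -/
theorem length_tabRow_le {f : List Bool → List Bool} {P : Polynomial ℕ}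
    (hf : ∀ x p a b, (f (boolPair x (boolPair p (boolPair a b)))).length ≤ P.eval x.length) (x p a : List Bool) :
    (tabRow f (boolPair x (boolPair p a))).length ≤ 0 * a.length + (X * (2 * P + 4)).eval x.length := by
  rw [tabRow, Function.comp_apply]
  set w := fanoutFn (nthF 0) (fanoutFn (fstF ∘ nthF 1) (fanoutFn (fanoutFn (fstF ∘ sndF ∘ nthF 1) (sndPow 1)) (sndF ∘ sndF ∘ nthF 1)))
    (boolPair x (boolPair p a))
  have h := length_mapLF_le (f := tabItem f) 0 (P := P) (length_tabItem_le hf) w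
  have e0 : fstF w = x := by simp [w]
  rw [e0] at h
  simp only [zero_mul, zero_add, eval_add, eval_mul, eval_ofNat, eval_X] at h ⊢
  exact h

/-- Semantics of `tabRow f` (`n ≤ |x|`). [folklore] -/
theorem tabRow_apply (f : List Bool → List Bool) (x : List Bool) (hn : n ≤ x.length) (prm u : List Bool) :
    tabRow f (boolPair x (boolPair (boolPair (encodeNat n) (boolPair prm (encList (List.ofFn fun j : Fin n => ones j)))) u)) =
      encList (List.ofFn fun j : Fin n => f (boolPair x (boolPair prm (boolPair u (ones j))))) := by
  simp only [tabRow, Function.comp_apply, fanoutFn_apply, nthF_zero_boolPair, nthF_succ_boolPair, sndPow_succ_boolPair,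
    sndPow_zero, sndF_boolPair, fstF_boolPair]
  rw [mapLF_apply _ _ _ hn, List.take_of_length_le (by simp), List.map_ofFn]
  refine congrArg encList (congrArg List.ofFn (funext fun j => ?_))
  simp [tabItem_boolPair]

/-- **Tabulation** on `⟨x, ⟨nn, prm⟩⟩`: the table of `f ⟨x, ⟨prm, ⟨1ⁱ, 1ʲ⟩⟩⟩`, `i, j < n = ⟦nn⟧` (the map of
`tabRow f` over the index list, with parameter `⟨nn, ⟨prm, index list⟩⟩`). [cite: AroraBarak2009, §1.3 (bounded loops)] -/
def tab2F (f : List Bool → List Bool) : List Bool → List Bool :=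
  mapLF (tabRow f) ∘ fanoutFn (nthF 0) (fanoutFn (nthF 1)
    (fanoutFn (fanoutFn (nthF 1) (fanoutFn (sndPow 1) (idxListF ∘ fanoutFn (nthF 0) (nthF 1))))
      (idxListF ∘ fanoutFn (nthF 0) (nthF 1))))

/-- `tab2F f ∈ FP` for an absolutely bounded item function `f ∈ FP`. [folklore] -/
theorem tab2F_mem_FP {f : List Bool → List Bool} (hF : f ∈ FP) {P : Polynomial ℕ}
    (hf : ∀ x p a b, (f (boolPair x (boolPair p (boolPair a b)))).length ≤ P.eval x.length) : tab2F f ∈ FP :=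
  comp_mem_FP (mapLF_mem_FP (tabRow_mem_FP hF hf) (w := 0) (by norm_num) (length_tabRow_le hf))
    (fanoutFn_mem_FP (nthF_mem_FP 0) (fanoutFn_mem_FP (nthF_mem_FP 1)
      (fanoutFn_mem_FP (fanoutFn_mem_FP (nthF_mem_FP 1) (fanoutFn_mem_FP (sndPow_mem_FP 1)
        (comp_mem_FP idxListF_mem_FP (fanoutFn_mem_FP (nthF_mem_FP 0) (nthF_mem_FP 1)))))
        (comp_mem_FP idxListF_mem_FP (fanoutFn_mem_FP (nthF_mem_FP 0) (nthF_mem_FP 1))))))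

/-- **Semantics of `tab2F`** (`n ≤ |x|`). [folklore] -/
theorem tab2F_apply (f : List Bool → List Bool) (x : List Bool) (hn : n ≤ x.length) (prm : List Bool) :
    tab2F f (boolPair x (boolPair (encodeNat n) prm)) =
      tabCode fun i j : Fin n => f (boolPair x (boolPair prm (boolPair (ones i) (ones j)))) := by
  simp only [tab2F, Function.comp_apply, fanoutFn_apply, nthF_zero_boolPair, nthF_succ_boolPair, sndPow_succ_boolPair,
    sndPow_zero, sndF_boolPair]
  rw [idxListF_apply x hn, mapLF_apply _ _ _ hn, List.take_of_length_le (by simp), List.map_ofFn, tabCode]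
  refine congrArg encList (congrArg List.ofFn (funext fun i => ?_))
  simp only [Function.comp_apply]
  exact tabRow_apply f x hn prm (ones i)

end ThetaFWMachine

end Literature.Computability.Complexity

end
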